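import Mathlib
import Summits.Ventures.PercRepro2.Defs
import Summits.Ventures.PercRepro2.Harris
import Summits.Ventures.PercRepro2.Graph
import Summits.Ventures.PercRepro2.Events
import Summits.Ventures.PercRepro2.BHKEvents
import Summits.Ventures.PercRepro2.BHKAvoidWeighted
import Summits.Ventures.PercRepro2.PsiPendantLemmas
import Summits.Ventures.PercRepro2.PsiUniSure
import Summits.Ventures.PercRepro2.PsiUniExplored
import Summits.Ventures.PercRepro2.PsiBernstein
import Summits.Ventures.PercRepro2.PsiTEdge
import Summits.Ventures.PercRepro2.PsiBernTMark

/-!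
# The open-world masses of the edge at the explored `t`-component (PercRepro2, p2)

Let `f` with `ends f = s(t', y)` be the only unpinned edge at the explored `t`-component `Λ` of `p`
(`t' ∈ Λ`; `s, o ∉ Λ`), `y` arbitrary off the component.  The two worlds of `PsiTEdge.lean` give
the eight open-world masses of the (Ψ)-slack in closed-world terms (`tgen_*_one`): with `Q⁰` sure,
`q¹ = P⁰(s ↮ y)`, `oL¹ = P⁰(y ↔ o, s ↮ y)`, `oH¹ = P⁰(s ↔ o, s ↮ y)`, `aH¹ = P⁰(s ↔ u, s ↮ y)`,
`oLH¹ = P⁰(s ↔ u, y ↔ o, s ↮ y)`, `oHH¹ = P⁰(s ↔ u, s ↔ o, s ↮ y)`, `Ug¹ = P⁰(C_s ∈ 𝓤, s ↮ y)`,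
`oLU¹ = P⁰(C_s ∈ 𝓤, y ↔ o, s ↮ y)`.  The mixed Bernstein coefficients then read
`T₁ = C·Ug¹ + Ug·A′ + B` and `T₂ = B₁ + B₂ + Ug·(q¹·oHH¹ − aH¹·oH¹) + Ug¹·A′` (P2-G18-BERN.md §3.3,
§7.2), and two inequalities of the CLOSED world close them — **(R2-1)**
`aH¹·So + oH¹·Su + oL¹·Su ≤ oHH¹ + oLH¹ + q¹·SS` and **(Ψ₀′)** `q¹·oLU¹ ≤ Ug·(oL¹·(q¹ − aH¹) + q¹·oLH¹)`
— together with Harris, the avoid-world cross-cluster bound `bhk_cross_cluster` and the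
avoid-conditioned same-cluster PA `bhk_same_cluster_events`.  So the hypothesis of the frame
`psi_slack_nonneg_of_bern_t` is met at every such instance whose closed world satisfies (R2-1) and
(Ψ₀′) — the reduction (Ψ) ⟸ (BERN_t) ⟸ (R2-1) ∧ (Ψ₀′) of record, in the kernel.

* `tgen_q_one`, `tgen_oL_one`, `tgen_oH_one`, `tgen_aH_one`, `tgen_oLH_one`, `tgen_oHH_one`,
  `tgen_Ug_one`, `tgen_oLU_one` — the open-world masses;
* `psi_bern_t_of_r21_psi0` — **`0 ≤ T₁ ∧ 0 ≤ T₂` from (R2-1) and (Ψ₀′) at the closed world**.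
-/

namespace Summit.Ventures.PercRepro2

section TGeneral

variable {V : Type*} [Fintype V] [DecidableEq V] {E : Type*} [Fintype E] [DecidableEq E]
  {R : Type*} [CommRing R] [LinearOrder R] [IsStrictOrderedRing R]

omit [Fintype V] [DecidableEq V] [IsStrictOrderedRing R] in
/-- With `f = (t', y)` open, `Q` is `{s ↮ y}` of the closed world. -/
lemma tgen_q_one (p : E → R) (ends : E → Sym2 V) (s t t' y : V) (f : E)
    (hf : ends f = s(t', y)) (ht' : Conn ends (fun e => decide (p e = 1)) t t')
    (hs : ¬ Conn ends (fun e => decide (p e = 1)) t s) (hpf1 : p f ≠ 1)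
    (hpin : ∀ e, e ≠ f → (∃ v ∈ ends e, Conn ends (fun e => decide (p e = 1)) t v) →
      p e = 0 ∨ p e = 1) :
    prob (Function.update p f 1) (connEvent ends s t)ᶜ =
      prob (Function.update p f 0) (connEvent ends s y)ᶜ := by
  refine prob_update_one_eq_prob_update_zero_of_respects p f fun ω h0 h1 => ?_
  simp only [Set.mem_compl_iff, mem_connEvent]
  exact not_congr (conn_update_true_s_t_iff hf ht' hs hpf1 hpin h0 h1)

omit [Fintype V] [DecidableEq V] [IsStrictOrderedRing R] in
/-- With `f = (t', y)` open and `o` off the explored component, `{o ∈ C_t} ∩ Q` is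
`{y ↔ o, s ↮ y}` of the closed world. -/
lemma tgen_oL_one (p : E → R) (ends : E → Sym2 V) (s t t' y o : V) (f : E)
    (hf : ends f = s(t', y)) (ht' : Conn ends (fun e => decide (p e = 1)) t t')
    (hs : ¬ Conn ends (fun e => decide (p e = 1)) t s) (hpf1 : p f ≠ 1)
    (hpin : ∀ e, e ≠ f → (∃ v ∈ ends e, Conn ends (fun e => decide (p e = 1)) t v) →
      p e = 0 ∨ p e = 1) (ho : ¬ Conn ends (fun e => decide (p e = 1)) t o) :
    prob (Function.update p f 1) (clusterInEvent ends t {W : Set V | o ∈ W} ∩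
      (connEvent ends s t)ᶜ) =
      prob (Function.update p f 0) (connEvent ends y o ∩ (connEvent ends s y)ᶜ) := by
  refine prob_update_one_eq_prob_update_zero_of_respects p f fun ω h0 h1 => ?_
  simp only [Set.mem_inter_iff, mem_clusterInEvent, Set.mem_setOf_eq, mem_cluster,
    Set.mem_compl_iff, mem_connEvent]
  constructor
  · rintro ⟨hto, hst⟩
    rcases (conn_update_true_t_iff hf ht' hpf1 hpin h0 h1 o).1 hto with h | h
    · exact absurd h ho
    · exact ⟨h, (not_congr (conn_update_true_s_t_iff hf ht' hs hpf1 hpin h0 h1)).1 hst⟩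
  · rintro ⟨hyo, hsy⟩
    exact ⟨(conn_update_true_t_iff hf ht' hpf1 hpin h0 h1 o).2 (Or.inr hyo), (not_congr (conn_update_true_s_t_iff hf ht' hs hpf1 hpin h0 h1)).2 hsy⟩

omit [Fintype V] [DecidableEq V] [IsStrictOrderedRing R] in
/-- With `f = (t', y)` open, `{o ∈ C_s} ∩ Q` is `{s ↔ o, s ↮ y}` of the closed world. -/
lemma tgen_oH_one (p : E → R) (ends : E → Sym2 V) (s t t' y o : V) (f : E)
    (hf : ends f = s(t', y)) (ht' : Conn ends (fun e => decide (p e = 1)) t t')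
    (hs : ¬ Conn ends (fun e => decide (p e = 1)) t s) (hpf1 : p f ≠ 1)
    (hpin : ∀ e, e ≠ f → (∃ v ∈ ends e, Conn ends (fun e => decide (p e = 1)) t v) →
      p e = 0 ∨ p e = 1) :
    prob (Function.update p f 1) (clusterInEvent ends s {W : Set V | o ∈ W} ∩
      (connEvent ends s t)ᶜ) =
      prob (Function.update p f 0) (clusterInEvent ends s {W : Set V | o ∈ W} ∩
        (connEvent ends s y)ᶜ) := by
  refine prob_update_one_eq_prob_update_zero_of_respects p f fun ω h0 h1 => ?_
  simp only [Set.mem_inter_iff, mem_clusterInEvent, Set.mem_setOf_eq, mem_cluster,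
    Set.mem_compl_iff, mem_connEvent]
  constructor
  · rintro ⟨hso, hst⟩
    exact ⟨(conn_update_true_s_iff_of_not_conn hf ht' hs hpf1 hpin h0 h1 hst o).1 hso, fun h => hst ((conn_update_true_s_t_iff hf ht' hs hpf1 hpin h0 h1).2 h)⟩
  · rintro ⟨hso, hsy⟩
    have hst : ¬ Conn ends (Function.update ω f true) s t := fun h => hsy ((conn_update_true_s_t_iff hf ht' hs hpf1 hpin h0 h1).1 h)
    exact ⟨(conn_update_true_s_iff_of_not_conn hf ht' hs hpf1 hpin h0 h1 hst o).2 hso, hst⟩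

omit [Fintype V] [DecidableEq V] [IsStrictOrderedRing R] in
/-- With `f = (t', y)` open, `{s ↔ u} ∩ Q` is `{s ↔ u, s ↮ y}` of the closed world. -/
lemma tgen_aH_one (p : E → R) (ends : E → Sym2 V) (s t t' y u : V) (f : E)
    (hf : ends f = s(t', y)) (ht' : Conn ends (fun e => decide (p e = 1)) t t')
    (hs : ¬ Conn ends (fun e => decide (p e = 1)) t s) (hpf1 : p f ≠ 1)
    (hpin : ∀ e, e ≠ f → (∃ v ∈ ends e, Conn ends (fun e => decide (p e = 1)) t v) →
      p e = 0 ∨ p e = 1) :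
    prob (Function.update p f 1) (connEvent ends s u ∩ (connEvent ends s t)ᶜ) =
      prob (Function.update p f 0) (connEvent ends s u ∩ (connEvent ends s y)ᶜ) := by
  refine prob_update_one_eq_prob_update_zero_of_respects p f fun ω h0 h1 => ?_
  simp only [Set.mem_inter_iff, Set.mem_compl_iff, mem_connEvent]
  constructor
  · rintro ⟨hsu, hst⟩
    exact ⟨(conn_update_true_s_iff_of_not_conn hf ht' hs hpf1 hpin h0 h1 hst u).1 hsu, fun h => hst ((conn_update_true_s_t_iff hf ht' hs hpf1 hpin h0 h1).2 h)⟩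
  · rintro ⟨hsu, hsy⟩
    have hst : ¬ Conn ends (Function.update ω f true) s t := fun h => hsy ((conn_update_true_s_t_iff hf ht' hs hpf1 hpin h0 h1).1 h)
    exact ⟨(conn_update_true_s_iff_of_not_conn hf ht' hs hpf1 hpin h0 h1 hst u).2 hsu, hst⟩

omit [Fintype V] [DecidableEq V] [IsStrictOrderedRing R] in
/-- With `f = (t', y)` open and `o` off the component, `{s ↔ u} ∩ {o ∈ C_t} ∩ Q` is
`{s ↔ u, y ↔ o, s ↮ y}` of the closed world. -/
lemma tgen_oLH_one (p : E → R) (ends : E → Sym2 V) (s t t' y o u : V) (f : E)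
    (hf : ends f = s(t', y)) (ht' : Conn ends (fun e => decide (p e = 1)) t t')
    (hs : ¬ Conn ends (fun e => decide (p e = 1)) t s) (hpf1 : p f ≠ 1)
    (hpin : ∀ e, e ≠ f → (∃ v ∈ ends e, Conn ends (fun e => decide (p e = 1)) t v) →
      p e = 0 ∨ p e = 1) (ho : ¬ Conn ends (fun e => decide (p e = 1)) t o) :
    prob (Function.update p f 1) (connEvent ends s u ∩ clusterInEvent ends t {W : Set V | o ∈ W} ∩
      (connEvent ends s t)ᶜ) =
      prob (Function.update p f 0) (connEvent ends s u ∩ connEvent ends y o ∩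
        (connEvent ends s y)ᶜ) := by
  refine prob_update_one_eq_prob_update_zero_of_respects p f fun ω h0 h1 => ?_
  simp only [Set.mem_inter_iff, mem_clusterInEvent, Set.mem_setOf_eq, mem_cluster,
    Set.mem_compl_iff, mem_connEvent]
  constructor
  · rintro ⟨⟨hsu, hto⟩, hst⟩
    rcases (conn_update_true_t_iff hf ht' hpf1 hpin h0 h1 o).1 hto with h | h
    · exact absurd h ho
    · exact ⟨⟨(conn_update_true_s_iff_of_not_conn hf ht' hs hpf1 hpin h0 h1 hst u).1 hsu, h⟩, fun h' => hst ((conn_update_true_s_t_iff hf ht' hs hpf1 hpin h0 h1).2 h')⟩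
  · rintro ⟨⟨hsu, hyo⟩, hsy⟩
    have hst : ¬ Conn ends (Function.update ω f true) s t := fun h => hsy ((conn_update_true_s_t_iff hf ht' hs hpf1 hpin h0 h1).1 h)
    exact ⟨⟨(conn_update_true_s_iff_of_not_conn hf ht' hs hpf1 hpin h0 h1 hst u).2 hsu, (conn_update_true_t_iff hf ht' hpf1 hpin h0 h1 o).2 (Or.inr hyo)⟩, hst⟩

omit [Fintype V] [DecidableEq V] [IsStrictOrderedRing R] in
/-- With `f = (t', y)` open, `{s ↔ u} ∩ {o ∈ C_s} ∩ Q` is `{s ↔ u, s ↔ o, s ↮ y}` of the closed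
world. -/
lemma tgen_oHH_one (p : E → R) (ends : E → Sym2 V) (s t t' y o u : V) (f : E)
    (hf : ends f = s(t', y)) (ht' : Conn ends (fun e => decide (p e = 1)) t t')
    (hs : ¬ Conn ends (fun e => decide (p e = 1)) t s) (hpf1 : p f ≠ 1)
    (hpin : ∀ e, e ≠ f → (∃ v ∈ ends e, Conn ends (fun e => decide (p e = 1)) t v) →
      p e = 0 ∨ p e = 1) :
    prob (Function.update p f 1) (connEvent ends s u ∩ clusterInEvent ends s {W : Set V | o ∈ W} ∩
      (connEvent ends s t)ᶜ) =
      prob (Function.update p f 0) (connEvent ends s u ∩ clusterInEvent ends s {W : Set V | o ∈ W} ∩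
        (connEvent ends s y)ᶜ) := by
  refine prob_update_one_eq_prob_update_zero_of_respects p f fun ω h0 h1 => ?_
  simp only [Set.mem_inter_iff, mem_clusterInEvent, Set.mem_setOf_eq, mem_cluster,
    Set.mem_compl_iff, mem_connEvent]
  constructor
  · rintro ⟨⟨hsu, hso⟩, hst⟩
    exact ⟨⟨(conn_update_true_s_iff_of_not_conn hf ht' hs hpf1 hpin h0 h1 hst u).1 hsu, (conn_update_true_s_iff_of_not_conn hf ht' hs hpf1 hpin h0 h1 hst o).1 hso⟩, fun h => hst ((conn_update_true_s_t_iff hf ht' hs hpf1 hpin h0 h1).2 h)⟩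
  · rintro ⟨⟨hsu, hso⟩, hsy⟩
    have hst : ¬ Conn ends (Function.update ω f true) s t := fun h => hsy ((conn_update_true_s_t_iff hf ht' hs hpf1 hpin h0 h1).1 h)
    exact ⟨⟨(conn_update_true_s_iff_of_not_conn hf ht' hs hpf1 hpin h0 h1 hst u).2 hsu, (conn_update_true_s_iff_of_not_conn hf ht' hs hpf1 hpin h0 h1 hst o).2 hso⟩, hst⟩

omit [Fintype V] [DecidableEq V] [IsStrictOrderedRing R] in
/-- With `f = (t', y)` open, `{C_s ∈ 𝓤} ∩ Q` is `{C_s ∈ 𝓤, s ↮ y}` of the closed world. -/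
lemma tgen_Ug_one (p : E → R) (ends : E → Sym2 V) (s t t' y : V) (f : E)
    (hf : ends f = s(t', y)) (ht' : Conn ends (fun e => decide (p e = 1)) t t')
    (hs : ¬ Conn ends (fun e => decide (p e = 1)) t s) (hpf1 : p f ≠ 1)
    (hpin : ∀ e, e ≠ f → (∃ v ∈ ends e, Conn ends (fun e => decide (p e = 1)) t v) →
      p e = 0 ∨ p e = 1) (𝓤 : Set (Set V)) :
    prob (Function.update p f 1) (clusterInEvent ends s 𝓤 ∩ (connEvent ends s t)ᶜ) =
      prob (Function.update p f 0) (clusterInEvent ends s 𝓤 ∩ (connEvent ends s y)ᶜ) := by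
  refine prob_update_one_eq_prob_update_zero_of_respects p f fun ω h0 h1 => ?_
  simp only [Set.mem_inter_iff, mem_clusterInEvent, Set.mem_compl_iff, mem_connEvent]
  constructor
  · rintro ⟨hU, hst⟩
    have hc : cluster ends (Function.update ω f true) s = cluster ends (Function.update ω f false) s := by
      ext x
      simp only [mem_cluster]
      exact conn_update_true_s_iff_of_not_conn hf ht' hs hpf1 hpin h0 h1 hst x
    exact ⟨hc ▸ hU, fun h => hst ((conn_update_true_s_t_iff hf ht' hs hpf1 hpin h0 h1).2 h)⟩
  · rintro ⟨hU, hsy⟩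
    have hst : ¬ Conn ends (Function.update ω f true) s t := fun h => hsy ((conn_update_true_s_t_iff hf ht' hs hpf1 hpin h0 h1).1 h)
    have hc : cluster ends (Function.update ω f true) s = cluster ends (Function.update ω f false) s := by
      ext x
      simp only [mem_cluster]
      exact conn_update_true_s_iff_of_not_conn hf ht' hs hpf1 hpin h0 h1 hst x
    exact ⟨hc ▸ hU, hst⟩

omit [Fintype V] [DecidableEq V] [IsStrictOrderedRing R] in
/-- With `f = (t', y)` open and `o` off the component, `{C_s ∈ 𝓤} ∩ {o ∈ C_t} ∩ Q` is
`{C_s ∈ 𝓤, y ↔ o, s ↮ y}` of the closed world. -/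
lemma tgen_oLU_one (p : E → R) (ends : E → Sym2 V) (s t t' y o : V) (f : E)
    (hf : ends f = s(t', y)) (ht' : Conn ends (fun e => decide (p e = 1)) t t')
    (hs : ¬ Conn ends (fun e => decide (p e = 1)) t s) (hpf1 : p f ≠ 1)
    (hpin : ∀ e, e ≠ f → (∃ v ∈ ends e, Conn ends (fun e => decide (p e = 1)) t v) →
      p e = 0 ∨ p e = 1) (ho : ¬ Conn ends (fun e => decide (p e = 1)) t o) (𝓤 : Set (Set V)) :
    prob (Function.update p f 1) (clusterInEvent ends s 𝓤 ∩ clusterInEvent ends t {W : Set V | o ∈ W} ∩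
      (connEvent ends s t)ᶜ) =
      prob (Function.update p f 0) (clusterInEvent ends s 𝓤 ∩ connEvent ends y o ∩
        (connEvent ends s y)ᶜ) := by
  refine prob_update_one_eq_prob_update_zero_of_respects p f fun ω h0 h1 => ?_
  simp only [Set.mem_inter_iff, mem_clusterInEvent, Set.mem_setOf_eq, mem_cluster,
    Set.mem_compl_iff, mem_connEvent]
  constructor
  · rintro ⟨⟨hU, hto⟩, hst⟩
    have hc : cluster ends (Function.update ω f true) s = cluster ends (Function.update ω f false) s := by
      ext x
      simp only [mem_cluster]
      exact conn_update_true_s_iff_of_not_conn hf ht' hs hpf1 hpin h0 h1 hst x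
    rcases (conn_update_true_t_iff hf ht' hpf1 hpin h0 h1 o).1 hto with h | h
    · exact absurd h ho
    · exact ⟨⟨hc ▸ hU, h⟩, fun h' => hst ((conn_update_true_s_t_iff hf ht' hs hpf1 hpin h0 h1).2 h')⟩
  · rintro ⟨⟨hU, hyo⟩, hsy⟩
    have hst : ¬ Conn ends (Function.update ω f true) s t := fun h => hsy ((conn_update_true_s_t_iff hf ht' hs hpf1 hpin h0 h1).1 h)
    have hc : cluster ends (Function.update ω f true) s = cluster ends (Function.update ω f false) s := by
      ext x
      simp only [mem_cluster]
      exact conn_update_true_s_iff_of_not_conn hf ht' hs hpf1 hpin h0 h1 hst x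
    exact ⟨⟨hc ▸ hU, (conn_update_true_t_iff hf ht' hpf1 hpin h0 h1 o).2 (Or.inr hyo)⟩, hst⟩

end TGeneral

end Summit.Ventures.PercRepro2
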